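import Summits.Ventures.YMGap.RobustBall.StarKernelClusteringZd
import Summits.Ventures.YMGap.RobustBall.UniformPlaquetteSusceptibility
import HarnessLib

/-!
# Venture YMGap, track DS (seat ds-3) — «C-KMIX-STAR», step 3: the finite-volume plaquette SUSCEPTIBILITY and the
# extensive ENERGY-VARIANCE ceiling on centred boxes, UNIFORM in the box AND in the boundary field, through the
# `ℤ^d` vertex-star doors; `SU(2)`, `d = 4`, Wilson, every `0 ≤ β_W ≤ 9/25`, hypothesis-free

HONEST FRAMING. WHAT THIS IS: a venture file (cell `pub-ymgap`, track DS, seat ds-3; theorems only, no `def`, no named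
fact): the star-door twin of the seat's `KernelSusceptibility.lean` (single-link door, `β_W ≤ 1/12`, all volumes).
`StarKernelClusteringZd.lean` bounds the covariances of the finite-volume Gibbs distribution `γ_{Λ₀}(·|η)` in the INTERIOR
form `ρ^{min(⌊dist/4⌋, ⌊depth/4⌋)}`. On a CENTRED box `Λ₀ =` links based in `box d M` the depth of a plaquette based in
`box d P`, `P < M`, is `≥ M − P`, while a plaquette based in `box d M` is at distance `≤ M + P` from it — so the saturation
costs at most `ρ^{−(P/2 + 3/2)}` and the two-point bound becomes a plain sup-norm exponential with ONE constant for all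
`M > P` and all `η`:
* `abs_cov_plaquette_kernel_box_le_of_starWindowBoundZd` — door level (ds-1's Wilson door `StarWindowBoundZd d N β ρ`):
  `|cov_{γ_{box M}(·|η)}(W_p, W_q)| ≤ 2048 N⁷ · e^{t(P/2+3/2)} · e^{−(t/4)‖x_p − x_q‖_∞}`, `t = −log max(ρ, ½) > 0`;
* `sum_abs_cov_plaquette_kernel_box_le_of_starWindowBoundZd` — the finite-volume susceptibility at `p`:
  `Σ_{q based in box M} |cov_{γ_{box M}(·|η)}(W_p, W_q)| ≤ 2048 N⁷ e^{t(P/2+3/2)} · D_d · ((1 + e^{−t/(4d)})/(1 − e^{−t/(4d)}))^d`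
  (`D_d = numOrient d` orientations; rb-p1's lattice sum `summable_and_tsum_row_le`), ONE bound for all `M > P`, all `η`;
* `variance_sum_plaquette_kernel_box_le_of_starWindowBoundZd` — `Var_{γ_{box M}(·|η)}(Σ_{p ∈ Ps} W_p) ≤ χ · #Ps` for every
  set `Ps` of plaquettes based in `box d P`: no volume-growing energy-fluctuation peak, whatever the boundary field;
* ★★★ `su2_wilson_kernel_susceptibility_star_box`, `su2_wilson_kernel_energyVariance_star_box` — `SU(2)`, `d = 4`, WILSON,
  EVERY `0 ≤ β_W ≤ 9/25`, HYPOTHESIS-FREE (Lemma G on the torus of side `5` + the torus → `ℤ⁴` transfer), `ρ = R_G(β_W)`,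
  constant `262144 · e^{t(P/2+3/2)} · 6 · ((1 + e^{−t/16})/(1 − e^{−t/16}))⁴`.
WHAT THIS IS NOT: the bound is astronomically weak near the frontier (`t ≈ 3·10⁻³` at `β_W = 9/25`) and says nothing about
plaquettes near the boundary of the box (interior form); strong-coupling LATTICE statements; nothing about the continuum
limit or the Clay Millennium problem.

References: R. L. Dobrushin, S. B. Shlosman (1985) Thm. 1, (1987) §3; H. Föllmer, LNM 1362 (1988) Ch. I (2.10), Thm. (2.13);
B. Simon, *The Statistical Mechanics of Lattice Gases* I (1993) §II.12; the seat's `StarKernelClusteringZd.lean`,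
`KernelSusceptibility.lean`; rb-p1's `IsotropicPairWitness.lean` (`summable_and_tsum_row_le`), `UniformPlaquetteSusceptibility.lean`.
-/

noncomputable section

open MeasureTheory ProbabilityTheory Function Finset Real
open scoped NNReal
open Literature.Probability.LatticeModels
open Literature.Probability.LatticeModels.DobrushinMetric (IsLipBound integrable_of_abs_le')
open Literature.MathematicalPhysics.QuantumLattice
open Literature.MathematicalPhysics.QuantumFieldTheory hiding ZdEdge
open Summit.Ventures.YMGap.DSWindowZd
open Summit.Ventures.YMGap.StarWindowGauge (gaugeR gaugeR_lt_one_of_le)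
open Summit.Ventures.YMGap.StarLemmaG (starWindowBound_lemmaG gaugeR_nonneg)

namespace Summit.Ventures.YMGap.RobustBall

variable {d N : ℕ}

/-! ### Geometry and arithmetic of the saturation -/

/-- The links of two plaquettes are at set distance at most the distance of the base points. [folklore] -/
theorem setDistEdges_plaquetteEdges_le (p q : ZdPlaquette d) :
    setDistEdges (plaquetteEdges p) (plaquetteEdges q) ≤ ‖p.1 - q.1‖ := by
  have h := setDistEdges_le_norm_sub (fst_mem_plaquetteEdges p) (fst_mem_plaquetteEdges q)
  exact h

/-- … and at least that distance minus `2` (each link is based within `1` of its base point). [folklore] -/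
theorem norm_sub_sub_two_le_setDistEdges_plaquetteEdges (p q : ZdPlaquette d) :
    ‖p.1 - q.1‖ - 2 ≤ setDistEdges (plaquetteEdges p) (plaquetteEdges q) := by
  refine le_setDistEdges_of_forall ⟨_, fst_mem_plaquetteEdges p⟩ ⟨_, fst_mem_plaquetteEdges q⟩ fun e he e' he' => ?_
  have h1 := norm_fst_sub_le_of_mem_plaquetteEdges he
  have h2 := norm_fst_sub_le_of_mem_plaquetteEdges he'
  have h3 : ‖p.1 - q.1‖ ≤ ‖p.1 - e.1‖ + ‖e.1 - e'.1‖ + ‖e'.1 - q.1‖ :=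
    (norm_sub_le_norm_sub_add_norm_sub p.1 e'.1 q.1).trans
      (add_le_add (norm_sub_le_norm_sub_add_norm_sub p.1 e.1 e'.1) le_rfl)
  rw [norm_sub_rev] at h1
  linarith

/-- A link of a plaquette based in `box d P` has sup-norm at most `P + 1`. [folklore] -/
theorem supNormZd_le_of_mem_plaquetteEdges_of_mem_box {p : ZdPlaquette d} {P : ℕ} (hp : p.1 ∈ box d P) {e : ZdEdge d}
    (he : e ∈ plaquetteEdges p) : (supNormZd e.1 : ℝ) ≤ P + 1 := by
  have hxP : (supNormZd p.1 : ℝ) ≤ P := by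
    have : supNormZd p.1 ≤ P := supNormZd_le_iff.2 fun i => by have := (mem_box.1 hp) i; omega
    exact_mod_cast this
  have h1 := norm_fst_sub_le_of_mem_plaquetteEdges he
  have h2 := supNormZd_le_supNormZd_add_norm e.1 p.1
  linarith

/-- The Lipschitz vector of a plaquette observable sums to at most `4 · 4N³`. [folklore] -/
theorem sum_lipVec_plaquetteEdges_le (p : ZdPlaquette d) :
    ∑ e ∈ plaquetteEdges p, (if e ∈ plaquetteEdges p then 1 * ((4 * (N : ℝ≥0) ^ 3 : ℝ≥0) : ℝ) else 0) ≤
      4 * (4 * (N : ℝ) ^ 3) := by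
  rw [Finset.sum_ite_of_true (fun e he => he), Finset.sum_const, nsmul_eq_mul, one_mul]
  have h4 : ((plaquetteEdges p).card : ℝ) ≤ 4 := by exact_mod_cast card_plaquetteEdges_le p
  have hN3 : (0 : ℝ) ≤ 4 * (N : ℝ) ^ 3 := by positivity
  push_cast
  exact mul_le_mul_of_nonneg_right h4 hN3

/-- **The saturation arithmetic.** For `0 ≤ ρ < 1`, reals `D ≥ n − 2` and naturals `M, P` with `n ≤ P + M`:
`ρ^{min(⌊D/4⌋, ⌊(M−P)/4⌋)} ≤ e^{t(P/2+3/2)} e^{−(t/4) n}`, `t = −log max(ρ, ½)` (both floors are `≥ n/4 − P/2 − 3/2`). [folklore] -/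
theorem pow_min_floor_le_exp {ρ D n : ℝ} {M P : ℕ} (hρ0 : 0 ≤ ρ) (hρ1 : ρ < 1) (hDn : n - 2 ≤ D) (hn : n ≤ P + M) :
    ρ ^ (min ⌊D / (2 + 2 : ℕ)⌋₊ ⌊((M : ℝ) - P) / (2 + 2 : ℕ)⌋₊) ≤
      Real.exp (-Real.log (max ρ (1 / 2)) * (P / 2 + 3 / 2)) * Real.exp (-(-Real.log (max ρ (1 / 2)) / 4) * n) := by
  set a : ℕ := ⌊D / (2 + 2 : ℕ)⌋₊ with ha
  set b : ℕ := ⌊((M : ℝ) - P) / (2 + 2 : ℕ)⌋₊ with hb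
  have h22 : ((2 + 2 : ℕ) : ℝ) = 4 := by norm_num
  have ha' : D / 4 - 1 ≤ (a : ℝ) := by
    have := Nat.lt_floor_add_one (D / (2 + 2 : ℕ))
    rw [h22] at this
    rw [ha]; linarith
  have hb' : ((M : ℝ) - P) / 4 - 1 ≤ (b : ℝ) := by
    have := Nat.lt_floor_add_one (((M : ℝ) - P) / (2 + 2 : ℕ))
    rw [h22] at this
    rw [hb]; linarith
  have he : n / 4 - (P / 2 + 3 / 2) ≤ ((min a b : ℕ) : ℝ) := by
    have hP0 : (0 : ℝ) ≤ P := Nat.cast_nonneg P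
    rcases Nat.le_total a b with hab | hab
    · rw [min_eq_left hab]; linarith
    · rw [min_eq_right hab]; linarith
  set ρ' : ℝ := max ρ (1 / 2) with hρ'
  have hρ'0 : 0 < ρ' := lt_max_of_lt_right (by norm_num)
  have hρ'1 : ρ' ≤ 1 := max_le hρ1.le (by norm_num)
  have hlog : Real.log ρ' ≤ 0 := Real.log_nonpos hρ'0.le hρ'1
  calc ρ ^ (min a b) ≤ ρ' ^ (min a b) := pow_le_pow_left₀ hρ0 (le_max_left _ _) _
    _ = Real.exp ((min a b : ℕ) * Real.log ρ') := by
        rw [Real.exp_nat_mul, Real.exp_log hρ'0]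
    _ ≤ Real.exp ((n / 4 - (P / 2 + 3 / 2)) * Real.log ρ') :=
        Real.exp_le_exp.2 (mul_le_mul_of_nonpos_right he hlog)
    _ = Real.exp (-Real.log ρ' * (P / 2 + 3 / 2)) * Real.exp (-(-Real.log ρ' / 4) * n) := by
        rw [← Real.exp_add]; congr 1; ring

/-- Monotonicity of the product `k · X · S₁ · S₂` in its last three (non-negative) factors. [folklore] -/
theorem mul_mul_mul_le_of_le {k X E S₁ S₂ T : ℝ} (hk : 0 ≤ k) (hX : X ≤ E) (h₁ : S₁ ≤ T) (h₂ : S₂ ≤ T)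
    (hS₁ : 0 ≤ S₁) (hS₂ : 0 ≤ S₂) (hE : 0 ≤ E) (hT : 0 ≤ T) : k * X * S₁ * S₂ ≤ k * E * T * T :=
  mul_le_mul (mul_le_mul (mul_le_mul_of_nonneg_left hX hk) h₁ hS₁ (mul_nonneg hk hE)) h₂ hS₂
    (mul_nonneg (mul_nonneg hk hE) hT)

/-! ### Door level: the two-point bound on a centred box, saturation absorbed -/

/-- **PLAQUETTE–PLAQUETTE COVARIANCES OF THE BOX KERNEL, ANY BOUNDARY FIELD, through ds-1's Wilson star door.**
`StarWindowBoundZd d N β ρ suFrobDist` with `0 ≤ ρ < 1`; `Λ₀ =` the links based in `box d M`; `p` a plaquette based in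
`box d P`, `P < M`; `q` a plaquette based in `box d M`; `η` ANY boundary field. Then, with `t = −log max(ρ, ½)`,
`|cov_{γ_{Λ₀}(·|η)}(W_p, W_q)| ≤ 2048 N⁷ · e^{t(P/2 + 3/2)} · e^{−(t/4)‖x_p − x_q‖_∞}` (`StarKernelClusteringZd` with the
depth function `M + 1 − ‖·‖_∞`: depth of `p` `≥ M − P`, `dist(p, q) ∈ [‖x_p − x_q‖ − 2, ‖x_p − x_q‖]`, `‖x_p − x_q‖ ≤ M + P`,
so `min(⌊dist/4⌋, ⌊(M−P)/4⌋) ≥ ‖x_p − x_q‖/4 − P/2 − 3/2`; `W` is a `4N³`-Lipschitz cylinder on `4` links). [folklore] -/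
theorem abs_cov_plaquette_kernel_box_le_of_starWindowBoundZd {β ρ : ℝ} (hρ0 : 0 ≤ ρ) (hρ1 : ρ < 1)
    (h : StarWindowBoundZd d N β ρ suFrobDist) {M P : ℕ} (hPM : P < M) (η : LGConfig d (SUN N))
    {p q : ZdPlaquette d} (hp : p.1 ∈ box d P) (hq : q.1 ∈ box d M) :
    |cov[zdPlaquetteObs (fundamentalRep (Fin N)) p.1 p.2.1.1 p.2.1.2,
        zdPlaquetteObs (fundamentalRep (Fin N)) q.1 q.2.1.1 q.2.1.2;
        ymSpecification (d := d) (fundamentalRep (Fin N)) β ((box d M) ×ˢ (Finset.univ : Finset (Fin d))) η]| ≤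
      2048 * (N : ℝ) ^ 7 * Real.exp (-Real.log (max ρ (1 / 2)) * (P / 2 + 3 / 2)) *
        Real.exp (-(-Real.log (max ρ (1 / 2)) / 4) * ‖p.1 - q.1‖) := by
  classical
  have hF₁ : IsLipschitzCylinder (fundamentalRep (Fin N)) (zdPlaquetteObs (fundamentalRep (Fin N)) p.1 p.2.1.1 p.2.1.2)
      (plaquetteEdges p) (4 * (N : ℝ≥0) ^ 3) := isLipschitzCylinder_zdPlaquetteObs p.1 p.2.2
  have hF₂ : IsLipschitzCylinder (fundamentalRep (Fin N)) (zdPlaquetteObs (fundamentalRep (Fin N)) q.1 q.2.1.1 q.2.1.2)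
      (plaquetteEdges q) (4 * (N : ℝ≥0) ^ 3) := isLipschitzCylinder_zdPlaquetteObs q.1 q.2.2
  have hA : ∀ a b : SUN N, dist (suEntries a) (suEntries b) ≤ 1 * suFrobDist a b := fun a b => by
    rw [one_mul]; exact dist_suEntries_le_suFrobDist a b
  -- sup-norm bookkeeping on the boxes
  have hxP : (supNormZd p.1 : ℝ) ≤ P := by
    have : supNormZd p.1 ≤ P := supNormZd_le_iff.2 fun i => by have := (mem_box.1 hp) i; omega
    exact_mod_cast this
  have hyM : (supNormZd q.1 : ℝ) ≤ M := by
    have : supNormZd q.1 ≤ M := supNormZd_le_iff.2 fun i => by have := (mem_box.1 hq) i; omega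
    exact_mod_cast this
  have hxy : ‖p.1 - q.1‖ ≤ (P : ℝ) + M := by
    calc ‖p.1 - q.1‖ ≤ ‖p.1‖ + ‖q.1‖ := norm_sub_le _ _
      _ ≤ supNormZd p.1 + supNormZd q.1 := add_le_add (norm_le_supNormZd _) (norm_le_supNormZd _)
      _ ≤ P + M := add_le_add hxP hyM
  -- the depth function of the box and the depth of `p`
  have hφ : ∀ a b : ZdEdge d, ((M : ℝ) + 1 - supNormZd a.1) ≤ ((M : ℝ) + 1 - supNormZd b.1) + ‖a.1 - b.1‖ := by
    intro a b
    have h1 := supNormZd_le_supNormZd_add_norm b.1 a.1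
    rw [norm_sub_rev] at h1
    linarith
  have hφΛ : ∀ a : ZdEdge d, 0 < ((M : ℝ) + 1 - supNormZd a.1) → a ∈ (box d M) ×ˢ (Finset.univ : Finset (Fin d)) := by
    intro a ha
    refine Finset.mem_product.2 ⟨mem_box.2 fun i => ?_, Finset.mem_univ _⟩
    have h1 : (supNormZd a.1 : ℝ) < M + 1 := by linarith
    have h1' : supNormZd a.1 < M + 1 := by exact_mod_cast h1
    have h3 := natAbs_le_supNormZd a.1 i
    omega
  have hΔ₁Λ : plaquetteEdges p ⊆ (box d M) ×ˢ (Finset.univ : Finset (Fin d)) := by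
    intro e he
    refine Finset.mem_product.2 ⟨mem_box.2 fun i => ?_, Finset.mem_univ _⟩
    have h1' : supNormZd e.1 ≤ P + 1 := by exact_mod_cast supNormZd_le_of_mem_plaquetteEdges_of_mem_box hp he
    have h3 := natAbs_le_supNormZd e.1 i
    omega
  have hm : ∀ e ∈ plaquetteEdges p, ((M : ℝ) - P) ≤ (M : ℝ) + 1 - supNormZd e.1 := by
    intro e he
    have := supNormZd_le_of_mem_plaquetteEdges_of_mem_box hp he
    linarith
  have key := abs_covariance_kernel_le_of_starWindowBoundZd (d := d) (N := N) hρ0 hρ1 h _ η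
    (fun a => (M : ℝ) + 1 - supNormZd a.1) hφ hφΛ hF₁.measurable hF₂.measurable hF₁.abs_le hF₂.abs_le
    hF₁.dependsOn hF₂.dependsOn (hF₁.isLipBound zero_le_one hA) (hF₂.isLipBound zero_le_one hA) hΔ₁Λ hm
  have hpow := pow_min_floor_le_exp (D := setDistEdges (plaquetteEdges p) (plaquetteEdges q)) (M := M) (P := P) hρ0 hρ1
    (norm_sub_sub_two_le_setDistEdges_plaquetteEdges p q) hxy
  have hS₁ := sum_lipVec_plaquetteEdges_le (N := N) p
  have hS₂ := sum_lipVec_plaquetteEdges_le (N := N) q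
  have hS₁0 : 0 ≤ ∑ e ∈ plaquetteEdges p, (if e ∈ plaquetteEdges p then 1 * ((4 * (N : ℝ≥0) ^ 3 : ℝ≥0) : ℝ) else 0) :=
    Finset.sum_nonneg fun e _ => by positivity
  have hS₂0 : 0 ≤ ∑ e ∈ plaquetteEdges q, (if e ∈ plaquetteEdges q then 1 * ((4 * (N : ℝ≥0) ^ 3 : ℝ≥0) : ℝ) else 0) :=
    Finset.sum_nonneg fun e _ => by positivity
  have hN0 : (0 : ℝ) ≤ N := Nat.cast_nonneg N
  have hsq : (2 * Real.sqrt N) ^ 2 = 4 * N := by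
    rw [mul_pow, Real.sq_sqrt hN0]; ring
  rw [hsq] at key
  refine key.trans ?_
  clear key
  have hE0 : 0 ≤ Real.exp (-Real.log (max ρ (1 / 2)) * (P / 2 + 3 / 2)) *
      Real.exp (-(-Real.log (max ρ (1 / 2)) / 4) * ‖p.1 - q.1‖) := by positivity
  have hk : (0 : ℝ) ≤ 2 * (4 * (N : ℝ)) := by positivity
  have hT : (0 : ℝ) ≤ 4 * (4 * (N : ℝ) ^ 3) := by positivity
  refine (mul_mul_mul_le_of_le hk hpow hS₁ hS₂ hS₁0 hS₂0 hE0 hT).trans (le_of_eq ?_)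
  ring

/-! ### The finite-volume susceptibility and the energy-variance ceiling, uniform in `(M, η)` -/

/-- **THE FINITE-VOLUME PLAQUETTE SUSCEPTIBILITY IS BOUNDED UNIFORMLY IN THE BOX AND THE BOUNDARY FIELD** (door level, `d ≥ 1`).
Under `StarWindowBoundZd d N β ρ suFrobDist`, `0 ≤ ρ < 1`: for every `M > P`, EVERY boundary field `η` and every plaquette `p`
based in `box d P`, the row over all plaquettes `q` based in `box d M` satisfies
`Σ_q |cov_{γ_{box M}(·|η)}(W_p, W_q)| ≤ 2048 N⁷ e^{t(P/2+3/2)} · D_d · ((1 + e^{−t/(4d)})/(1 − e^{−t/(4d)}))^d`, `t = −log max(ρ, ½)`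
(the two-point bound above, `e^{−(t/4)‖v‖_∞} ≤ (e^{−t/(4d)})^{‖v‖₁}`, rb-p1's `summable_and_tsum_row_le`). [folklore] -/
theorem sum_abs_cov_plaquette_kernel_box_le_of_starWindowBoundZd (hd : 1 ≤ d) {β ρ : ℝ} (hρ0 : 0 ≤ ρ) (hρ1 : ρ < 1)
    (h : StarWindowBoundZd d N β ρ suFrobDist) {M P : ℕ} (hPM : P < M) (η : LGConfig d (SUN N))
    {p : ZdPlaquette d} (hp : p.1 ∈ box d P) :
    ∑ q ∈ (box d M) ×ˢ (Finset.univ : Finset {o : Fin d × Fin d // o.1 < o.2}),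
      |cov[zdPlaquetteObs (fundamentalRep (Fin N)) p.1 p.2.1.1 p.2.1.2,
        zdPlaquetteObs (fundamentalRep (Fin N)) q.1 q.2.1.1 q.2.1.2;
        ymSpecification (d := d) (fundamentalRep (Fin N)) β ((box d M) ×ˢ (Finset.univ : Finset (Fin d))) η]| ≤
      2048 * (N : ℝ) ^ 7 * Real.exp (-Real.log (max ρ (1 / 2)) * (P / 2 + 3 / 2)) *
        (numOrient d * ((1 + Real.exp (-(-Real.log (max ρ (1 / 2)) / 4 / d))) /
          (1 - Real.exp (-(-Real.log (max ρ (1 / 2)) / 4 / d)))) ^ d) := by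
  classical
  set t : ℝ := -Real.log (max ρ (1 / 2)) with ht
  have ht0 : 0 < t := by
    rw [ht, neg_pos]
    exact Real.log_neg (lt_max_of_lt_right (by norm_num)) (max_lt hρ1 (by norm_num))
  set C : ℝ := 2048 * (N : ℝ) ^ 7 * Real.exp (t * (P / 2 + 3 / 2)) with hC
  have hC0 : 0 ≤ C := by positivity
  set r : ℝ := Real.exp (-(t / 4 / d)) with hr
  have hr0 : 0 ≤ r := (Real.exp_pos _).le
  have hdpos : (0 : ℝ) < d := by exact_mod_cast (show 0 < d by omega)
  have hr1 : r < 1 := by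
    rw [hr]
    exact Real.exp_lt_one_iff.2 (neg_neg_of_pos (by positivity))
  have hpt : ∀ q ∈ (box d M) ×ˢ (Finset.univ : Finset {o : Fin d × Fin d // o.1 < o.2}),
      |cov[zdPlaquetteObs (fundamentalRep (Fin N)) p.1 p.2.1.1 p.2.1.2,
        zdPlaquetteObs (fundamentalRep (Fin N)) q.1 q.2.1.1 q.2.1.2;
        ymSpecification (d := d) (fundamentalRep (Fin N)) β ((box d M) ×ˢ (Finset.univ : Finset (Fin d))) η]| ≤
        C * r ^ l1 (p.1 - q.1) := by
    intro q hq
    have hq1 : q.1 ∈ box d M := (Finset.mem_product.1 hq).1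
    refine (abs_cov_plaquette_kernel_box_le_of_starWindowBoundZd hρ0 hρ1 h hPM η hp hq1).trans ?_
    rw [← ht]
    refine mul_le_mul_of_nonneg_left ?_ hC0
    have := exp_neg_norm_le_pow hd (m := t / 4) (by positivity) (p.1 - q.1)
    rw [hr]
    convert this using 2
  have hrow := summable_and_tsum_row_le (d := d) hC0 hr0 hr1 p
  calc ∑ q ∈ (box d M) ×ˢ (Finset.univ : Finset {o : Fin d × Fin d // o.1 < o.2}),
        |cov[zdPlaquetteObs (fundamentalRep (Fin N)) p.1 p.2.1.1 p.2.1.2,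
          zdPlaquetteObs (fundamentalRep (Fin N)) q.1 q.2.1.1 q.2.1.2;
          ymSpecification (d := d) (fundamentalRep (Fin N)) β ((box d M) ×ˢ (Finset.univ : Finset (Fin d))) η]|
      ≤ ∑ q ∈ (box d M) ×ˢ (Finset.univ : Finset {o : Fin d × Fin d // o.1 < o.2}), C * r ^ l1 (p.1 - q.1) :=
        Finset.sum_le_sum hpt
    _ ≤ ∑' q : ZdPlaquette d, C * r ^ l1 (p.1 - q.1) :=
        hrow.1.sum_le_tsum _ fun q _ => by positivity
    _ ≤ C * (numOrient d * ((1 + r) / (1 - r)) ^ d) := hrow.2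

/-- **THE EXTENSIVE ENERGY-VARIANCE CEILING, UNIFORM IN THE BOX AND THE BOUNDARY FIELD** (door level, `d ≥ 1`): under the same door,
for every `M > P`, EVERY `η` and every finite set `Ps` of plaquettes based in `box d P`:
`Var_{γ_{box M}(·|η)}(Σ_{p ∈ Ps} W_p) ≤ χ · #Ps` with the `χ` of `sum_abs_cov_plaquette_kernel_box_le_of_starWindowBoundZd`
(`Var = Σ_p Σ_q cov ≤ Σ_p Σ_{q ⊆ box M} |cov|`). [folklore] -/
theorem variance_sum_plaquette_kernel_box_le_of_starWindowBoundZd (hd : 1 ≤ d) {β ρ : ℝ} (hρ0 : 0 ≤ ρ) (hρ1 : ρ < 1)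
    (h : StarWindowBoundZd d N β ρ suFrobDist) {M P : ℕ} (hPM : P < M) (η : LGConfig d (SUN N))
    {Ps : Finset (ZdPlaquette d)} (hPs : ∀ p ∈ Ps, p.1 ∈ box d P) :
    Var[fun U => ∑ p ∈ Ps, zdPlaquetteObs (fundamentalRep (Fin N)) p.1 p.2.1.1 p.2.1.2 U;
        ymSpecification (d := d) (fundamentalRep (Fin N)) β ((box d M) ×ˢ (Finset.univ : Finset (Fin d))) η] ≤
      2048 * (N : ℝ) ^ 7 * Real.exp (-Real.log (max ρ (1 / 2)) * (P / 2 + 3 / 2)) *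
        (numOrient d * ((1 + Real.exp (-(-Real.log (max ρ (1 / 2)) / 4 / d))) /
          (1 - Real.exp (-(-Real.log (max ρ (1 / 2)) / 4 / d)))) ^ d) * Ps.card := by
  classical
  haveI : SecondCountableTopology (Matrix (Fin N) (Fin N) ℂ) :=
    inferInstanceAs (SecondCountableTopology (Fin N → Fin N → ℂ))
  haveI : SecondCountableTopology (SUN N) := Topology.IsEmbedding.subtypeVal.secondCountableTopology
  have hγ : IsSpecification (ymSpecification (d := d) (fundamentalRep (Fin N)) β) :=
    isSpecification_ymSpecification_of_t2Space _ (continuous_fundamentalRep (Fin N)) _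
  set μ := ymSpecification (d := d) (fundamentalRep (Fin N)) β ((box d M) ×ˢ (Finset.univ : Finset (Fin d))) η with hμ
  haveI : IsProbabilityMeasure μ := hγ.isProbability _ η
  set χ : ℝ := 2048 * (N : ℝ) ^ 7 * Real.exp (-Real.log (max ρ (1 / 2)) * (P / 2 + 3 / 2)) *
        (numOrient d * ((1 + Real.exp (-(-Real.log (max ρ (1 / 2)) / 4 / d))) /
          (1 - Real.exp (-(-Real.log (max ρ (1 / 2)) / 4 / d)))) ^ d) with hχ
  set W : ZdPlaquette d → LGConfig d (SUN N) → ℝ :=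
    fun p => zdPlaquetteObs (fundamentalRep (Fin N)) p.1 p.2.1.1 p.2.1.2 with hW
  have hWm : ∀ p : ZdPlaquette d, MemLp (W p) 2 μ := fun p =>
    memLp_of_bounded (a := -1) (b := 1)
      (ae_of_all _ fun U => by
        have h1 := abs_zdPlaquetteObs_le fundamentalRep_mem_unitaryGroup p.1 p.2.1.1 p.2.1.2 U
        simp only [Set.mem_Icc]; exact abs_le.1 h1)
      (isLipschitzCylinder_zdPlaquetteObs p.1 p.2.2).measurable.aestronglyMeasurable 2
  have hvar : Var[fun U => ∑ p ∈ Ps, W p U; μ] = ∑ p ∈ Ps, ∑ q ∈ Ps, cov[W p, W q; μ] := by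
    have hsum : (fun U => ∑ p ∈ Ps, W p U) = ∑ p ∈ Ps, W p := by funext U; simp
    rw [hsum, ← covariance_self (memLp_finsetSum' Ps fun p _ => hWm p).aestronglyMeasurable.aemeasurable,
      covariance_sum_sum' (fun p _ => hWm p) (fun q _ => hWm q)]
  have hPsS : Ps ⊆ (box d M) ×ˢ (Finset.univ : Finset {o : Fin d × Fin d // o.1 < o.2}) := by
    intro q hq
    refine Finset.mem_product.2 ⟨mem_box.2 fun i => ?_, Finset.mem_univ _⟩
    have := (mem_box.1 (hPs q hq)) i
    omega
  rw [hvar]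
  calc ∑ p ∈ Ps, ∑ q ∈ Ps, cov[W p, W q; μ] ≤ ∑ p ∈ Ps, ∑ q ∈ Ps, |cov[W p, W q; μ]| :=
        Finset.sum_le_sum fun p _ => Finset.sum_le_sum fun q _ => le_abs_self _
    _ ≤ ∑ p ∈ Ps, ∑ q ∈ (box d M) ×ˢ (Finset.univ : Finset {o : Fin d × Fin d // o.1 < o.2}), |cov[W p, W q; μ]| :=
        Finset.sum_le_sum fun p _ => Finset.sum_le_sum_of_subset_of_nonneg hPsS fun q _ _ => abs_nonneg _
    _ ≤ ∑ _p ∈ Ps, χ := Finset.sum_le_sum fun p hp =>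
        sum_abs_cov_plaquette_kernel_box_le_of_starWindowBoundZd hd hρ0 hρ1 h hPM η (hPs p hp)
    _ = χ * Ps.card := by rw [Finset.sum_const, nsmul_eq_mul, mul_comm]

/-! ### `SU(2)` lattice Yang–Mills on `ℤ⁴`, Wilson action, every `0 ≤ β_W ≤ 9/25`, hypothesis-free -/

/-- **`SU(2)`, `d = 4`, WILSON, EVERY `0 ≤ β_W ≤ 9/25`: PLAQUETTE–PLAQUETTE COVARIANCES OF THE BOX KERNEL, ANY BOUNDARY FIELD**: for
`M > P`, EVERY `η`, `p` based in `box 4 P`, `q` based in `box 4 M`, `t = −log max(R_G(β_W), ½)`: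
`|cov_{γ_{box M}(·|η)}(W_p, W_q)| ≤ 262144 · e^{t(P/2+3/2)} · e^{−(t/4)‖x_p − x_q‖_∞}` (compare `su2_wilson_kernel_plaquette_clustering_upTo_oneTwelfth`:
`524288 · 2^{−d(p,q)}` for all volumes at `β_W ≤ 1/12`). [folklore] -/
theorem su2_wilson_kernel_plaquette_clustering_star_box {βW : ℝ} (h0 : 0 ≤ βW) (h : βW ≤ 9 / 25) {M P : ℕ} (hPM : P < M)
    (η : LGConfig 4 (SUN 2)) {p q : ZdPlaquette 4} (hp : p.1 ∈ box 4 P) (hq : q.1 ∈ box 4 M) :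
    |cov[zdPlaquetteObs (fundamentalRep (Fin 2)) p.1 p.2.1.1 p.2.1.2,
        zdPlaquetteObs (fundamentalRep (Fin 2)) q.1 q.2.1.1 q.2.1.2;
        ymSpecification (d := 4) (fundamentalRep (Fin 2)) (βW / 2) ((box 4 M) ×ˢ (Finset.univ : Finset (Fin 4))) η]| ≤
      262144 * Real.exp (-Real.log (max (gaugeR βW) (1 / 2)) * (P / 2 + 3 / 2)) *
        Real.exp (-(-Real.log (max (gaugeR βW) (1 / 2)) / 4) * ‖p.1 - q.1‖) := by
  have hρ0 : 0 ≤ gaugeR βW := gaugeR_nonneg h0 (by linarith)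
  have hρ1 : gaugeR βW < 1 := gaugeR_lt_one_of_le h0 h
  have hZd : StarWindowBoundZd 4 2 (βW / 2) (gaugeR βW) suFrobDist :=
    starWindowBoundZd_of_starWindowBound (L := 5) le_rfl suFrobDist_nonneg (starWindowBound_lemmaG (by norm_num) h0 (by linarith))
  have key := abs_cov_plaquette_kernel_box_le_of_starWindowBoundZd (d := 4) (N := 2) hρ0 hρ1 hZd hPM η hp hq
  refine key.trans (le_of_eq ?_)
  norm_num

/-- ★★★ **`SU(2)`, `d = 4`, WILSON, EVERY `0 ≤ β_W ≤ 9/25`: THE FINITE-VOLUME PLAQUETTE SUSCEPTIBILITY ON CENTRED BOXES IS BOUNDED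
BY ONE CONSTANT FOR ALL BOXES AND ALL BOUNDARY FIELDS** (tree bare coupling `β_W/2`). For every `M > P`, EVERY boundary field `η` on
the box of side `2M+1` and every plaquette `p` based in `box 4 P`:
`Σ_{q based in box M} |cov_{γ_{box M}(·|η)}(W_p, W_q)| ≤ 262144 · e^{t(P/2+3/2)} · 6 · ((1 + e^{−t/16})/(1 − e^{−t/16}))⁴`,
`t = −log max(R_G(β_W), ½) > 0` — Lemma G on the torus of side `5`, the torus → `ℤ⁴` transfer, the geometric kernel star door.
Compare `su2_wilson_kernel_susceptibility_upTo_oneTwelfth` (all volumes, all plaquettes, `β_W ≤ 1/12`). [folklore] -/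
theorem su2_wilson_kernel_susceptibility_star_box {βW : ℝ} (h0 : 0 ≤ βW) (h : βW ≤ 9 / 25) {M P : ℕ} (hPM : P < M)
    (η : LGConfig 4 (SUN 2)) {p : ZdPlaquette 4} (hp : p.1 ∈ box 4 P) :
    ∑ q ∈ (box 4 M) ×ˢ (Finset.univ : Finset {o : Fin 4 × Fin 4 // o.1 < o.2}),
      |cov[zdPlaquetteObs (fundamentalRep (Fin 2)) p.1 p.2.1.1 p.2.1.2,
        zdPlaquetteObs (fundamentalRep (Fin 2)) q.1 q.2.1.1 q.2.1.2;
        ymSpecification (d := 4) (fundamentalRep (Fin 2)) (βW / 2) ((box 4 M) ×ˢ (Finset.univ : Finset (Fin 4))) η]| ≤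
      262144 * Real.exp (-Real.log (max (gaugeR βW) (1 / 2)) * (P / 2 + 3 / 2)) *
        (6 * ((1 + Real.exp (-(-Real.log (max (gaugeR βW) (1 / 2)) / 16))) /
          (1 - Real.exp (-(-Real.log (max (gaugeR βW) (1 / 2)) / 16)))) ^ 4) := by
  have hρ0 : 0 ≤ gaugeR βW := gaugeR_nonneg h0 (by linarith)
  have hρ1 : gaugeR βW < 1 := gaugeR_lt_one_of_le h0 h
  have hZd : StarWindowBoundZd 4 2 (βW / 2) (gaugeR βW) suFrobDist :=
    starWindowBoundZd_of_starWindowBound (L := 5) le_rfl suFrobDist_nonneg (starWindowBound_lemmaG (by norm_num) h0 (by linarith))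
  have key := sum_abs_cov_plaquette_kernel_box_le_of_starWindowBoundZd (d := 4) (N := 2) (by norm_num) hρ0 hρ1 hZd hPM η hp
  refine key.trans (le_of_eq ?_)
  have h16 : -Real.log (max (gaugeR βW) (1 / 2)) / 4 / ((4 : ℕ) : ℝ) = -Real.log (max (gaugeR βW) (1 / 2)) / 16 := by
    push_cast; ring
  rw [h16, numOrient_four]
  norm_num

/-- ★★★ **`SU(2)`, `d = 4`, WILSON, EVERY `0 ≤ β_W ≤ 9/25`: NO VOLUME-GROWING ENERGY-FLUCTUATION PEAK, WHATEVER THE BOUNDARY FIELD.**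
For every `M > P`, EVERY boundary field `η` and every finite set `Ps` of plaquettes based in `box 4 P`:
`Var_{γ_{box M}(·|η)}(Σ_{p ∈ Ps} W_p) ≤ 262144 · e^{t(P/2+3/2)} · 6 · ((1 + e^{−t/16})/(1 − e^{−t/16}))⁴ · #Ps`,
`t = −log max(R_G(β_W), ½)`: the finite-volume specific heat per plaquette of the interior is bounded by ONE constant for all boxes
and all boundary conditions. [folklore] -/
theorem su2_wilson_kernel_energyVariance_star_box {βW : ℝ} (h0 : 0 ≤ βW) (h : βW ≤ 9 / 25) {M P : ℕ} (hPM : P < M)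
    (η : LGConfig 4 (SUN 2)) {Ps : Finset (ZdPlaquette 4)} (hPs : ∀ p ∈ Ps, p.1 ∈ box 4 P) :
    Var[fun U => ∑ p ∈ Ps, zdPlaquetteObs (fundamentalRep (Fin 2)) p.1 p.2.1.1 p.2.1.2 U;
        ymSpecification (d := 4) (fundamentalRep (Fin 2)) (βW / 2) ((box 4 M) ×ˢ (Finset.univ : Finset (Fin 4))) η] ≤
      262144 * Real.exp (-Real.log (max (gaugeR βW) (1 / 2)) * (P / 2 + 3 / 2)) *
        (6 * ((1 + Real.exp (-(-Real.log (max (gaugeR βW) (1 / 2)) / 16))) /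
          (1 - Real.exp (-(-Real.log (max (gaugeR βW) (1 / 2)) / 16)))) ^ 4) * Ps.card := by
  have hρ0 : 0 ≤ gaugeR βW := gaugeR_nonneg h0 (by linarith)
  have hρ1 : gaugeR βW < 1 := gaugeR_lt_one_of_le h0 h
  have hZd : StarWindowBoundZd 4 2 (βW / 2) (gaugeR βW) suFrobDist :=
    starWindowBoundZd_of_starWindowBound (L := 5) le_rfl suFrobDist_nonneg (starWindowBound_lemmaG (by norm_num) h0 (by linarith))
  have key := variance_sum_plaquette_kernel_box_le_of_starWindowBoundZd (d := 4) (N := 2) (by norm_num) hρ0 hρ1 hZd hPM η hPs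
  refine key.trans (le_of_eq ?_)
  have h16 : -Real.log (max (gaugeR βW) (1 / 2)) / 4 / ((4 : ℕ) : ℝ) = -Real.log (max (gaugeR βW) (1 / 2)) / 16 := by
    push_cast; ring
  rw [h16, numOrient_four]
  norm_num

end Summit.Ventures.YMGap.RobustBall

end
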